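import Summits.BirchSwinnertonDyer.BirchSwinnertonDyer.Theorems.RamifiedSevenEllipticUnitsValueOfKMCImpReading
import Literature.NumberTheory.EllipticCurves.Kato2004.PerrinRiouRatio
import Summits.BirchSwinnertonDyer.Rank1Residual.Additive.KatoDescentClosedBindersContra
import Summits.BirchSwinnertonDyer.Rank1Residual.Additive.KatoDescentKMCImpReadingRowRealizable
import Summits.BirchSwinnertonDyer.Rank1Residual.Additive.KatoDescentKMCImpReadingIsogenyClass
import Summits.BirchSwinnertonDyer.Rank1Residual.Additive.KatoDescentRankOneCountRowsOfLoc
import Summits.BirchSwinnertonDyer.Rank1Residual.Additive.KatoDescentRealizableContraRankOne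
import Literature.NumberTheory.EllipticCurves.Kato2004.KatoMainConjectureCMOffMu
import Summits.BirchSwinnertonDyer.Rank1Residual.Additive.KatoDescentLengthEqualityOffMuClassCSeven
import Literature.NumberTheory.EllipticCurves.Wuthrich2014.ShaBoundProofs
import HarnessLib

set_option linter.dupNamespace false
set_option autoImplicit false

/-!
# DRAFT v9 of the skeleton line `kato-perrin-riou-zp` on crux `EllipticUnitValueSevenOfGZK` (stmt-BirchSwinnertonDyer-19945) —
# the `hex` binder swap 2a → 2a′ (MEMBER TRANSPORT) + Cassels back in the cite stub.  NOT REGISTERED, NOT the line of record.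

Author: ideator `bsd-idea-20` g52 (W-79: publish-only; the line of record `Lines/kato_perrin_riou_zp.lean` v8 9bf786a2f44a9354 is
UNTOUCHED; the cell planner `bsd-cm-plan` registers v9 with its own pen — ruling D841).  Namespace `…KatoPerrinRiouZpV9` so that this
draft can never collide with the record; the planner renames it to `…KatoPerrinRiouZp` at registration.  Imports = v8's ten imports +
`Literature.NumberTheory.EllipticCurves.Wuthrich2014.ShaBoundProofs` (for `Wuthrich2014.bsdp_of_isIsogenous`); Theses/Theorems/Literature
ONLY — no `Cruxes/…` import; the Prop vocabulary of the idea card (`AdmissibleAt`, `ExistsAdmissibleMemberSeven`) is INLINED verbatim into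
the stub statement (no `def` in this file: theorems only).

WHAT CHANGES vs v8 (decider memo `Cruxes/EllipticUnitValueSevenOfGZK/KatoMemberDecider-g52.md`, commit 77eaf66dc10d; card
`Ideas/kato-member-transport.md` REV 2).  v8's research stub 2a `stub_existsAdmissibleSeven` asks for an admissible Kato zeta class at
EVERY member of 𝒞₇.  Exact computation (Γ₀(49) modular symbols + Birch twisting): the image `[T_K(f_D)]` of Kato's lattice is the class of
`T₇(49a3^{(D)})` iff no prime factor of `D` is `≡ ±1 (mod 7)` (85 of the 132 classes with `|D| ≤ 3000`), and on those classes stub 2a AT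
THE MEMBERS `49a1^{(D)}`, `49a2^{(D)}` is equivalent to the vanishing of a mod-𝔭 obstruction `ob_D` that the line does not need.  v9 replaces
2a by the WEAKER

  2a′ `stub_existsAdmissibleMemberSeven` : every `W ∈ 𝒞₇` is `ℚ`-isogenous to SOME globally minimal `W'` carrying an admissible class
      (the ∃-body is v8's `hex` body VERBATIM at `W'`; intended witness: Kato's member `W_K` of the class, `T₇W_K ≅ V_{ℤ₇}(f_W)(1)`,
      NAMED by the decider: `W_K = 49a1^{(−7D)}` when no `ℓ ≡ ±1 (7)` divides `D`, else `W_K = 49a1^{(D)}`; there `𝐇¹` is Λ-free since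
      `W_K(ℚ)[7] = 0` — `KatoMemberTorsionLemma.lean` fb806d17453c — and integrality of `𝐳_γ` is Kato 13.12 + 13.14 at Kato's OWN lattice),

and pays for the lost uniformity with ONE transport of `BSD(·, 7)` along the isogeny `W ~ W'`: Cassels' invariance of the BSD quotient —
the tree's EXISTING named fact `bsdRHS_eq_of_isIsogenous` (`Literature/NumberTheory/EllipticCurves/BSDQuadraticDescent.lean`; Cassels 1965
/ Milne ADT I.7.3 / Dokchitser–Dokchitser 2010 §2.1), consumed through the PROVED `Wuthrich2014.bsdp_of_isIsogenous` exactly as k7r-c4's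
`ramifiedCMEllipticUnitIndexAt_of_bsdp` consumes it (`Finite Ш(W')` from GZK at analytic rank one, `leadingLCoeff W' ≠ 0` from modularity).
So the cite stub regains a FOURTH conjunct (v6's stub 6 had it; E56 removed it because v7/v8 had KMC at EVERY member):
`stub_printFactsKato : H2X′ ∧ exists_isNewformOf ∧ BT26 ∧ bsdRHS_eq_of_isIsogenous` — named-fact debt of the line +1 (Cassels), NO NEW
Literature declaration (nothing for k-ty1 to type).

COMPOSITION (v9).  Per member `W ∈ 𝒞₇`, GZK granted: 2a′ gives `W' ~ W` with an admissible class; `W' ∈ 𝒞₇`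
(`X12.ClassCSeven.of_isIsogenous`, E56 §0); `kmcFine_at W'` := ⟨the admissible class, `by_cases 𝔮 = (7)`: stub 2b at `W'` / BT26 off μ
(`StrictCount.katoLengthEqualityOffMu_classCSeven_of_fact`)⟩ = `KatoMainConjectureFineContra W' 7` (p737503's proof, pointwise);
`bsdpSeven_at W'` := E50 §1 `KMCImpReadingPointwise.rankOne_bsdp_of_countAt` at `W'` fed by `rowCount_closed`, `realizable_closed`, the
`→`-reading `conj1210_of_isKatoZetaDescentDatumOfContra_of_katoMainConjectureFineContra`, modularity, `not_seven_dvd_torsionOrder`, stub 1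
at `W'` = `BSDp W' 7`; then for every globally minimal `V ~ W`: `V ~ W'` and `Wuthrich2014.bsdp_of_isIsogenous (Cassels)` moves `BSD(W',7)`
to `V`; E56 §1's Cassels-free seam `ramifiedCMBottomClassIndexLawAtZp_of_bsdp_isogenyClass hGZK` concludes the crux's clause at `W`.
The crux is concluded BY NAME (`EllipticUnitValueSevenOfGZK_of`), no `sorry` outside the four `stub_*`.

STUBS after this file (4 = v8's count): `stub_perrinRiouRatioSeven` (RESEARCH, v8 VERBATIM), `stub_existsAdmissibleMemberSeven`
(RESEARCH, NEW — replaces `stub_existsAdmissibleSeven`; v8's 2a implies it with `W' = W`), `stub_katoMuEqualitySeven` (RESEARCH, v8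
VERBATIM — still ∀ members ∀ admissible `z₀`; it is only ever USED at `W'`), `stub_printFactsKato` (PURE-CITE, four named facts).
Nothing else changes: `rowCount_closed`, `realizable_closed` are v8 VERBATIM.

HONEST LABEL: stubs are `sorry`; nothing is asserted; 19945 stays OPEN; no stub is closed on the ledger; X12.CMRamifiedSeven is NOT
proved; BSD is claimed for no curve; no summit statement is proved by this seat.
[cite: Kato2004Asterisque, Thm. 12.5 (4) (p. 222), 13.12, 13.14, §15.16 (p. 150 of the Δ-quotient discussion)]
[cite: Cassels1965ArithmeticVIII] [cite: MilneADT2006, Thm. I.7.3 and Remark I.7.4] [cite: Wuthrich2014Integrality, Prop. 8]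
[cite: BurungaleTian2026, Thm. 2.6, Rem. 2.7 (p. 5)] [cite: BurnsKuriharaSano2019, Conj. 2.8 (ii) (p. 10), Thm. 7.6 (p. 29)]
-/

noncomputable section

open scoped Classical NumberField

open WeierstrassCurve Literature.NumberTheory.EllipticCurves
open Literature.NumberTheory.EllipticCurves.Rank1Residual
open Literature.NumberTheory.EllipticCurves.Rank1Residual.Typed
open Literature.NumberTheory.EllipticCurves.IwasawaAlgebra
open Literature.NumberTheory.EllipticCurves.Kato2004
open Summit.BirchSwinnertonDyer.Rank1Residual
open Summit.BirchSwinnertonDyer.Rank1Residual.Additive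
open Summit.BirchSwinnertonDyer.Rank1Residual.X12.O11
open Summit.BirchSwinnertonDyer.BirchSwinnertonDyer.Theses.RamifiedSevenEllipticUnits
open Summit.BirchSwinnertonDyer.BirchSwinnertonDyer.Theorems.RamifiedSevenEllipticUnits

namespace Summit.BirchSwinnertonDyer.BirchSwinnertonDyer.Cruxes.EllipticUnitValueSevenOfGZK.KatoPerrinRiouZpV9

/-- RESEARCH stub 1 (v8 VERBATIM) — Perrin-Riou's conjecture up to a `7`-adic unit for the twists `E_D`, `D ∈ 𝒞₇`, at the
additive prime `7`, over the CONSTRUCTED ratio `Kato2004.PRRatio` (v1.1). Row bsd-cm-7r-p1's statement.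
[cite: BurnsKuriharaSano2019, Conj. 2.8 (ii) (p. 10), Thm. 7.6 (p. 29)] [cite: PerrinRiou1993AIF, §3.3] -/
theorem stub_perrinRiouRatioSeven :
    ∀ (W : WeierstrassCurve ℚ) [W.IsElliptic] [W.IsGloballyMinimal] [Fact (Nat.Prime 7)],
      X12.ClassCSeven W → PerrinRiouUpToUnitAt Kato2004.PRRatio W 7 := by
  sorry

/-- RESEARCH stub 2a′ (v9; REPLACES v8's `stub_existsAdmissibleSeven`) — MEMBER TRANSPORT: every `W ∈ 𝒞₇` is `ℚ`-isogenous to a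
globally minimal curve `W'` on which an ADMISSIBLE Kato zeta class exists at `p = 7` (the ∃-body is v8's `hex` body VERBATIM at `W'`;
`W' ∈ 𝒞₇` is not asked — it follows by `X12.ClassCSeven.of_isIsogenous`).  Intended witness: Kato's member `W_K` of the class
(`T₇W_K = V_{ℤ₇}(f_W)(1)`, the image of `H₁(X₁(N), ℤ₇)`), NAMED by the g52 decider: `49a1^{(−7D)}` if no prime `ℓ ≡ ±1 (mod 7)` divides
`D`, else `49a1^{(D)}`; at `W_K` the strict `Δ`-trivial `𝐇¹` is `Λ`-FREE (`W_K(ℚ)[7] = 0`, `IwasawaH1Data.moduleFree_of_torsionBy_eq_bot`)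
and integrality of `𝐳_γ` at the height-one primes is Kato 13.12 (`𝔮 ≠ (7)`) + 13.14 with 13.6/13.10(2) at `(7)` FOR KATO'S LATTICE.
Why it might fail: the position clause of `IsAdmissibleZetaClass` at `𝔮 = (7)` could still see a `μ`-defect of `𝐳_γ` relative to the
`Ω`-normalisation even at Kato's lattice.  v8's 2a implies 2a′ (`W' = W`).
[cite: Kato2004Asterisque, Thm. 12.5 (4) (p. 222), 13.12, 13.14, 15.21] [cite: BurungaleTian2026, Thm. 2.4] -/
theorem stub_existsAdmissibleMemberSeven :
    ∀ (W : WeierstrassCurve ℚ) [W.IsElliptic] [W.IsGloballyMinimal] [Fact (Nat.Prime 7)], X12.ClassCSeven W →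
      ∃ (W' : WeierstrassCurve ℚ) (_ : W'.IsElliptic) (_ : W'.IsGloballyMinimal), IsIsogenous W W' ∧
        letI : ContinuousSMul ℤ_[7] (W'.tateModule 7) := TateModule.continuousSMul_padicInt
        ∃ (K : ZpExtension ℚ 7) (hK : K.IsCyclotomic) (γ : Field.absoluteGaloisGroup ℚ) (_ : K.IsTopGenerator γ)
          (I : IwasawaH1Data W' 7 K γ) (z₀ : I.H), Kato2004.IsAdmissibleZetaClass W' 7 K hK I z₀ := by
  sorry

/-- **Monotonicity (kernel): v8's stub 2a `stub_existsAdmissibleSeven` (its statement VERBATIM as the hypothesis) implies v9's 2a′**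
(take `W' = W`).  So v9 asks provers for LESS than v8 at this stub; the price is the Cassels conjunct of the cite stub.  No `sorry` here. -/
theorem existsAdmissibleMemberSeven_of_existsAdmissibleSeven
    (h2a : ∀ (W : WeierstrassCurve ℚ) [W.IsElliptic] [W.IsGloballyMinimal] [Fact (Nat.Prime 7)], X12.ClassCSeven W →
      letI : ContinuousSMul ℤ_[7] (W.tateModule 7) := TateModule.continuousSMul_padicInt
      ∃ (K : ZpExtension ℚ 7) (hK : K.IsCyclotomic) (γ : Field.absoluteGaloisGroup ℚ) (_ : K.IsTopGenerator γ)
        (I : IwasawaH1Data W 7 K γ) (z₀ : I.H), Kato2004.IsAdmissibleZetaClass W 7 K hK I z₀) :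
    ∀ (W : WeierstrassCurve ℚ) [W.IsElliptic] [W.IsGloballyMinimal] [Fact (Nat.Prime 7)], X12.ClassCSeven W →
      ∃ (W' : WeierstrassCurve ℚ) (_ : W'.IsElliptic) (_ : W'.IsGloballyMinimal), IsIsogenous W W' ∧
        letI : ContinuousSMul ℤ_[7] (W'.tateModule 7) := TateModule.continuousSMul_padicInt
        ∃ (K : ZpExtension ℚ 7) (hK : K.IsCyclotomic) (γ : Field.absoluteGaloisGroup ℚ) (_ : K.IsTopGenerator γ)
          (I : IwasawaH1Data W' 7 K γ) (z₀ : I.H), Kato2004.IsAdmissibleZetaClass W' 7 K hK I z₀ :=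
  fun W _ _ _ hC ↦ ⟨W, inferInstance, inferInstance, isIsogenous_self W, h2a W hC⟩

/-- RESEARCH stub 2b (v8 VERBATIM) — the μ-EQUALITY `μ(Y.X) = μ(𝐇¹ ⧸ Λz₀)` on 𝒞₇ at the height-one prime `(7)` for admissible `z₀`
(Burungale–Tian Rem. 2.7: OPEN IN PRINT).  In v9 it is only ever USED at the member `W'` of stub 2a′.
[cite: BurungaleTian2026, Rem. 2.7 (p. 5)] [cite: Kato2004Asterisque, §15.14, Lemma 15.22, Prop. 15.17] -/
theorem stub_katoMuEqualitySeven :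
    ∀ (W : WeierstrassCurve ℚ) [W.IsElliptic] [W.IsGloballyMinimal] [Fact (Nat.Prime 7)], X12.ClassCSeven W →
      letI : ContinuousSMul ℤ_[7] (W.tateModule 7) := TateModule.continuousSMul_padicInt
      ∀ (K : ZpExtension ℚ 7) (hK : K.IsCyclotomic) (γ : Field.absoluteGaloisGroup ℚ) (_ : K.IsTopGenerator γ)
        (I : IwasawaH1Data W 7 K γ) (z₀ : I.H), Kato2004.IsAdmissibleZetaClass W 7 K hK I z₀ →
        ∀ (Y : W.FineSelmerDualData K γ⁻¹) (𝔮 : PrimeSpectrum (IwasawaAlgebra 7)), 𝔮.asIdeal.height = 1 →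
          𝔮.asIdeal = IwasawaAlgebra.augIdealP 7 →
          Module.lengthAt (IwasawaAlgebra 7) Y.X 𝔮 =
            Module.lengthAt (IwasawaAlgebra 7) (I.H ⧸ (IwasawaAlgebra 7) ∙ z₀) 𝔮 := by
  sorry

/-- PRINT stub 5 (v9 = v8 + the FOURTH conjunct `bsdRHS_eq_of_isIsogenous` — Cassels' isogeny invariance of the BSD quotient, the
tree's EXISTING named fact in `Literature/NumberTheory/EllipticCurves/BSDQuadraticDescent.lean`; v6's cite stub 6 carried it, E56 removed
it for v7/v8 because KMC was then available at EVERY member; 2a′ gives KMC at ONE member per class, so one transport of `BSD(·,7)` along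
`W ~ W'` is needed again; named-fact debt +1, no new declaration).  Conjuncts 1–3 v8 VERBATIM: H2X′, modularity-with-level, BT26.
[cite: Cassels1965ArithmeticVIII] [cite: MilneADT2006, Thm. I.7.3 and Remark I.7.4] [cite: Kato2004Asterisque, §13.9 (p. 230), (17.13.1) (p. 279)]
[cite: BreuilConradDiamondTaylor2001, Thm. A] [cite: DiamondShurman2005, Thm. 8.8.1, Thm. 8.8.3] [cite: BurungaleTian2026, Thm. 2.6] -/
theorem stub_printFactsKato :
    Kato2004.exists_iwasawaH2Data_fineSelmerDual_embedding_loc ∧ ModularForms.exists_isNewformOf ∧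
      Kato2004.BurungaleTian2026_lengthEq_offMu_of_hasCM ∧ bsdRHS_eq_of_isIsogenous := by
  sorry

/-- **CLOSED IN-FILE (v9) — Kato's Main Conjecture (fine, contragredient) AT ONE MEMBER from an admissible class AT THAT MEMBER**:
p737503's proof of `StrictCount.katoMainConjectureFineContra_classCSeven_of_exists_of_fact_of_atMu` taken POINTWISE — the ∃-conjunct is
the hypothesis `hex`, the ∀-conjunct is `by_cases 𝔮 = (7)`: stub 2b at `W` / BT26 off μ (`StrictCount.katoLengthEqualityOffMu_classCSeven_of_fact`
with the cite conjunct `.2.2.1`).  No `sorry` here. -/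
theorem kmcFine_at :
    ∀ (W : WeierstrassCurve ℚ) [W.IsElliptic] [W.IsGloballyMinimal] [Fact (Nat.Prime 7)], X12.ClassCSeven W →
      (letI : ContinuousSMul ℤ_[7] (W.tateModule 7) := TateModule.continuousSMul_padicInt
        ∃ (K : ZpExtension ℚ 7) (hK : K.IsCyclotomic) (γ : Field.absoluteGaloisGroup ℚ) (_ : K.IsTopGenerator γ)
          (I : IwasawaH1Data W 7 K γ) (z₀ : I.H), Kato2004.IsAdmissibleZetaClass W 7 K hK I z₀) →
      KatoMainConjectureFineContra W 7 := by
  intro W _ _ _ hC hex hp7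
  refine ⟨hex, ?_⟩
  intro K hK γ hγ I z₀ hz₀ Y 𝔮 h𝔮
  by_cases h : 𝔮.asIdeal = IwasawaAlgebra.augIdealP 7
  · exact stub_katoMuEqualitySeven W hC K hK γ hγ I z₀ hz₀ Y 𝔮 h𝔮 h
  · exact StrictCount.katoLengthEqualityOffMu_classCSeven_of_fact stub_printFactsKato.2.2.1 W hC K hK γ hγ I z₀ hz₀ Y 𝔮 h𝔮 h

/-- **CLOSED IN-FILE (v8 VERBATIM) — v4's PRINT stub 3 ON THE ROWS, GZK-guarded** (E53, p726433).  No `sorry` here. -/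
theorem rowCount_closed :
    rank_eq_analyticRank_of_analyticRank_le_one →
      ∀ (W : WeierstrassCurve ℚ) [W.IsElliptic] [W.IsGloballyMinimal] [Fact (Nat.Prime 7)],
      X12.ClassCSeven W →
      ∀ (D : KatoDescentDatum 7) (ℒ : ℚ_[7]),
        IsKatoZetaDescentDatumOfContra W 7 D → Kato2004.PRRatio W 7 ℒ →
        Finite (coinvariants 7 D.H2) ∧ (ℒ ≠ 0 ↔ D.zetaIndex ≠ 0) ∧
          ∀ m : ℕ, D.zetaIndex = 7 ^ m * D.h2Card →
            ℒ.valuation = (m : ℤ) +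
              padicValNat 7 (Nat.card (AddCommGroup.primaryComponent W.sha 7)) +
              padicValNat 7 W.tamagawaProduct :=
  fun hGZK ↦ StrictCount.rankOneCountReading_classCSeven_of_loc_of_modularity hGZK stub_printFactsKato.2.1 stub_printFactsKato.1

/-- **CLOSED IN-FILE (v8 VERBATIM) — stub 4 ON THE ROWS, GZK-guarded** (E54, p725830).  No `sorry` here. -/
theorem realizable_closed :
    rank_eq_analyticRank_of_analyticRank_le_one →
      ∀ (W : WeierstrassCurve ℚ) [W.IsElliptic] [W.IsGloballyMinimal] [Fact (Nat.Prime 7)],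
      X12.ClassCSeven W →
      KatoMainConjectureFineContra W 7 → ∃ D : KatoDescentDatum 7, IsKatoZetaDescentDatumOfContra W 7 D :=
  StrictCount.realizableClassCSevenOfGZK_of_loc stub_printFactsKato.1

/-- **CLOSED IN-FILE (v9) — `BSD(W, 7)` AT A MEMBER CARRYING AN ADMISSIBLE CLASS**: E50 §1 `KMCImpReadingPointwise.rankOne_bsdp_of_countAt`
at `W` (count reading and realisation on the rows, the `→`-reading by `conj1210_of_isKatoZetaDescentDatumOfContra_of_katoMainConjectureFineContra`,
GZK, modularity from `exists_isNewformOf`, analytic rank one and `7 ∤ #W(ℚ)_tors` from `X12.ClassCSeven`, stub 1 and `kmcFine_at`).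
No `sorry` here. [cite: BurnsKuriharaSano2019, Thm. 7.6 (p. 29)] [cite: Miller2011LMS, §1 and Def. 1.1] -/
theorem bsdpSeven_at (hGZK : rank_eq_analyticRank_of_analyticRank_le_one)
    (W : WeierstrassCurve ℚ) [W.IsElliptic] [W.IsGloballyMinimal] [Fact (Nat.Prime 7)] (hC : X12.ClassCSeven W)
    (hex : letI : ContinuousSMul ℤ_[7] (W.tateModule 7) := TateModule.continuousSMul_padicInt
      ∃ (K : ZpExtension ℚ 7) (hK : K.IsCyclotomic) (γ : Field.absoluteGaloisGroup ℚ) (_ : K.IsTopGenerator γ)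
        (I : IwasawaH1Data W 7 K γ) (z₀ : I.H), Kato2004.IsAdmissibleZetaClass W 7 K hK I z₀) :
    BSDp W 7 :=
  KMCImpReadingPointwise.rankOne_bsdp_of_countAt (IsOf := IsKatoZetaDescentDatumOfContra)
    (PRRatio := Kato2004.PRRatio) (KMC := KatoMainConjectureFineContra) W 7
    (rowCount_closed hGZK W hC) (fun hK ↦ realizable_closed hGZK W hC hK)
    (fun _ _ _ _ _ _ hD hK ↦ conj1210_of_isKatoZetaDescentDatumOfContra_of_katoMainConjectureFineContra hD hK)
    hGZK (hasEntireLFunction_rat_of_exists_isNewformOf stub_printFactsKato.2.1) hC.2.2.1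
    (ValueOfKMCPerrinRiou.not_seven_dvd_torsionOrder W hC) (stub_perrinRiouRatioSeven W hC) (kmcFine_at W hC hex)

/-- **Composition (v9) — the crux BY NAME from the four stubs**: per member `W ∈ 𝒞₇` (GZK granted) take the member `W' ~ W` of stub 2a′,
prove `BSD(W', 7)` there (`bsdpSeven_at`, with `W' ∈ 𝒞₇` by `X12.ClassCSeven.of_isIsogenous`), move it to every globally minimal `V ~ W`
by Cassels (`Wuthrich2014.bsdp_of_isIsogenous stub_printFactsKato.2.2.2`; `V ~ W'` by symmetry/transitivity of isogeny; `Finite Ш(W')`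
from GZK, `leadingLCoeff W' ≠ 0` from modularity), and conclude the crux's clause at `W` by E56 §1's Cassels-free seam
`KMCImpReadingPointwise.ramifiedCMBottomClassIndexLawAtZp_of_bsdp_isogenyClass`.  No `sorry` here. -/
theorem EllipticUnitValueSevenOfGZK_of :
    Summit.BirchSwinnertonDyer.BirchSwinnertonDyer.Theses.RamifiedSevenEllipticUnits.EllipticUnitValueSevenOfGZK := by
  intro hGZK W _ _ _ hC
  obtain ⟨W', hE', hM', hiso, hex⟩ := stub_existsAdmissibleMemberSeven W hC
  haveI := hE'
  haveI := hM'
  have hC' : X12.ClassCSeven W' := hC.of_isIsogenous hiso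
  have hB' : BSDp W' 7 := bsdpSeven_at hGZK W' hC' hex
  have hfin' : Finite W'.sha := (hGZK W' (by rw [hC'.2.2.1])).2
  have hlead' : W'.leadingLCoeff ≠ 0 :=
    W'.leadingLCoeff_ne_zero_holds (hasEntireLFunction_rat_of_exists_isNewformOf stub_printFactsKato.2.1 W')
  exact KMCImpReadingPointwise.ramifiedCMBottomClassIndexLawAtZp_of_bsdp_isogenyClass hGZK fun V _ _ hisoV ↦
    Wuthrich2014.bsdp_of_isIsogenous stub_printFactsKato.2.2.2 (hisoV.symm_of_charZero.trans' hiso) hfin' hlead' hB'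

end Summit.BirchSwinnertonDyer.BirchSwinnertonDyer.Cruxes.EllipticUnitValueSevenOfGZK.KatoPerrinRiouZpV9

end
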